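import Literature.Probability.LatticeModels.DiscretePoissonSummation
import Mathlib.Analysis.Normed.Group.Int
import HarnessLib

/-!
# Decay of a periodized kernel in the torus distance, uniformly in the period

Topic `Probability/LatticeModels`; continuation of `DiscretePoissonSummation.lean` (the torus
kernel with periodic boundary conditions is the sum over images `Σ_{n ∈ ℤ^d} a(z + Ln)` of the
infinite-lattice kernel `a`, Glimm–Jaffe 1987 Prop. 7.3.1 on the lattice).

**Statement** (`tsum_norm_translate_le_of_decay`). If `|a(x)| ≤ C (1 + |x|)^{-K}` on `ℤ^d`
(sup norm) and `Σ_n (1 + |n|)^{-K} < ∞`, then for every period `L ≥ 1` and every CENTRED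
representative `z` (`2|z| ≤ L`, i.e. `|z|` is the torus distance of `z̄` to `0`):

  `Σ_{n ∈ ℤ^d} |a(z + Ln)| ≤ C (1 + 4^K Σ_n (1 + |n|)^{-K}) (1 + |z|)^{-K}`,

so the periodized kernel obeys THE SAME power-law decay in the torus distance as `a` does in `ℤ^d`,
with a constant independent of `L` (`norm_tsum_translate_le_of_decay`). This is the mechanism
behind "our bounds can be adapted also to the finite `L` case, and the resulting estimates turn
out to be uniform in `L`" (Benfatto–Giuliani–Mastropietro 2006, §2.2 footnote 1; Glimm–Jaffe
1987 §7.3: "estimates based on (7.3.1)"): every non-zero image is far, quantitatively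
`(1 + |z|)(1 + |n|) ≤ 4 (1 + |z + Ln|)` for `n ≠ 0`, `2|z| ≤ L` (`key_ineq`).

Everything is PROVED; no definition.

## References

* J. Glimm, A. Jaffe, *Quantum Physics. A Functional Integral Point of View*, 2nd ed. (1987),
  §7.3, Prop. 7.3.1 and the estimates following it. [GlimmJaffeQP1987]
* G. Benfatto, A. Giuliani, V. Mastropietro, Ann. Henri Poincaré 7 (2006) 809–898, §2.2
  footnote 1 (arXiv:cond-mat/0507686 p. 8). [BenfattoGiulianiMastropietro2006]
-/

noncomputable section

open Finset Filter
open scoped Topology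

namespace Literature.Probability.LatticeModels

variable {d : ℕ}

/-! ### Sup-norm geometry of the images `z + Ln` -/

/-- A non-zero integer vector has sup norm at least `1` (private twin of the lemma of the same name
in `Literature.Barriers.CriticalPhenomena.LongRangeIsing`, not imported here). [folklore] -/
private theorem one_le_norm_of_ne_zero {n : Site d} (hn : n ≠ 0) : (1 : ℝ) ≤ ‖n‖ := by
  obtain ⟨i, hi⟩ : ∃ i, n i ≠ 0 := by
    by_contra h
    push Not at h
    exact hn (funext h)
  calc (1 : ℝ) ≤ ‖n i‖ := by
        rw [Int.norm_eq_abs]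
        exact_mod_cast Int.one_le_abs hi
    _ ≤ ‖n‖ := norm_le_pi_norm n i

/-- **The images are far**: `L|n| - |z| ≤ |z + Ln|` (sup norms). [folklore] -/
theorem sub_le_norm_translate (L : ℕ) (z n : Site d) :
    (L : ℝ) * ‖n‖ - ‖z‖ ≤ ‖z + (L : ℤ) • n‖ := by
  rcases Nat.eq_zero_or_pos L with hL | hL
  · subst hL
    simp only [Nat.cast_zero, zero_mul, zero_sub]
    exact (neg_nonpos.2 (norm_nonneg _)).trans (norm_nonneg _)
  · have hLr : (0 : ℝ) < L := by exact_mod_cast hL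
    rw [sub_le_iff_le_add, mul_comm, ← le_div_iff₀ hLr,
      pi_norm_le_iff_of_nonneg (by positivity)]
    intro i
    rw [le_div_iff₀ hLr]
    have h1 : ‖n i‖ * L = ‖(z + (L : ℤ) • n) i - z i‖ := by
      rw [Int.norm_eq_abs, Int.norm_eq_abs]
      simp only [Pi.add_apply, Pi.smul_apply, smul_eq_mul, add_sub_cancel_left]
      push_cast
      rw [abs_mul, Nat.abs_cast, mul_comm]
    rw [h1]
    calc ‖(z + (L : ℤ) • n) i - z i‖ ≤ ‖(z + (L : ℤ) • n) i‖ + ‖z i‖ := norm_sub_le _ _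
      _ ≤ ‖z + (L : ℤ) • n‖ + ‖z‖ := add_le_add (norm_le_pi_norm _ i) (norm_le_pi_norm _ i)

/-- **Key inequality**: for a non-zero image index `n`, a centred representative `z`
(`2|z| ≤ L`) and `L ≥ 1`, `(1 + |z|)(1 + |n|) ≤ 4 (1 + |z + Ln|)`. [folklore] -/
theorem key_ineq {L : ℕ} (hL : 1 ≤ L) {z n : Site d} (hz : 2 * ‖z‖ ≤ L) (hn : n ≠ 0) :
    (1 + ‖z‖) * (1 + ‖n‖) ≤ 4 * (1 + ‖z + (L : ℤ) • n‖) := by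
  have h1 := one_le_norm_of_ne_zero hn
  have h2 := sub_le_norm_translate L z n
  have hLr : (1 : ℝ) ≤ L := by exact_mod_cast hL
  have hz0 := norm_nonneg z
  nlinarith [mul_le_mul_of_nonneg_left h1 (by linarith : (0 : ℝ) ≤ L),
    mul_le_mul_of_nonneg_right hLr (by linarith : (0 : ℝ) ≤ ‖n‖)]

/-- **Decay transfer to the images**: for `n ≠ 0`, `2|z| ≤ L`, `L ≥ 1`,
`(1 + |z + Ln|)^{-K} ≤ 4^K (1 + |z|)^{-K} (1 + |n|)^{-K}`. [folklore] -/
theorem inv_pow_translate_le {L : ℕ} (hL : 1 ≤ L) {z n : Site d} (hz : 2 * ‖z‖ ≤ L) (hn : n ≠ 0)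
    (K : ℕ) :
    ((1 + ‖z + (L : ℤ) • n‖) ^ K)⁻¹ ≤ (4 : ℝ) ^ K * ((1 + ‖z‖) ^ K)⁻¹ * ((1 + ‖n‖) ^ K)⁻¹ := by
  have hkey := key_ineq hL hz hn
  have hq : 0 < (1 + ‖z‖) * (1 + ‖n‖) / 4 := by positivity
  have hle : ((1 + ‖z‖) * (1 + ‖n‖) / 4) ^ K ≤ (1 + ‖z + (L : ℤ) • n‖) ^ K :=
    pow_le_pow_left₀ hq.le (by linarith [hkey]) K
  calc ((1 + ‖z + (L : ℤ) • n‖) ^ K)⁻¹ ≤ (((1 + ‖z‖) * (1 + ‖n‖) / 4) ^ K)⁻¹ :=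
        inv_anti₀ (pow_pos hq K) hle
    _ = (4 : ℝ) ^ K * ((1 + ‖z‖) ^ K)⁻¹ * ((1 + ‖n‖) ^ K)⁻¹ := by
        rw [div_pow, mul_pow, inv_div]
        ring

/-! ### The periodized kernel decays like the kernel, uniformly in `L` -/

/-- **Uniform-in-`L` decay of the sum over images** (Glimm–Jaffe 1987 §7.3; BGM 2006 footnote 1):
if `|a(x)| ≤ C(1 + |x|)^{-K}` on `ℤ^d` and `S_K = Σ_n (1 + |n|)^{-K} < ∞`, then for `L ≥ 1` and every
centred representative `z` (`2|z| ≤ L`),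
`Σ_n |a(z + Ln)| ≤ C (1 + 4^K S_K) (1 + |z|)^{-K}`. [cite: GlimmJaffeQP1987, §7.3] -/
theorem tsum_norm_translate_le_of_decay {a : Site d → ℂ} {C : ℝ} {K : ℕ} (hC : 0 ≤ C)
    (ha : ∀ x, ‖a x‖ ≤ C * ((1 + ‖x‖) ^ K)⁻¹)
    (hS : Summable fun n : Site d => ((1 + ‖n‖) ^ K)⁻¹)
    {L : ℕ} (hL : 1 ≤ L) {z : Site d} (hz : 2 * ‖z‖ ≤ L) :
    ∑' n : Site d, ‖a (z + (L : ℤ) • n)‖ ≤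
      C * (1 + (4 : ℝ) ^ K * ∑' n : Site d, ((1 + ‖n‖) ^ K)⁻¹) * ((1 + ‖z‖) ^ K)⁻¹ := by
  classical
  set w : ℝ := ((1 + ‖z‖) ^ K)⁻¹ with hw
  have hw0 : 0 ≤ w := by positivity
  -- the majorant `b n = C w (δ_{n,0} + 4^K (1+|n|)^{-K})`
  set b : Site d → ℝ := fun n => C * w * ((if n = 0 then 1 else 0) + (4 : ℝ) ^ K * ((1 + ‖n‖) ^ K)⁻¹)
    with hb
  have hb_summ : Summable b := by
    refine Summable.mul_left _ (Summable.add ?_ (hS.mul_left _))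
    exact summable_of_ne_finset_zero (s := {0}) fun n hn => by
      rw [Finset.mem_singleton] at hn; rw [if_neg hn]
  have hle : ∀ n, ‖a (z + (L : ℤ) • n)‖ ≤ b n := by
    intro n
    by_cases hn : n = 0
    · subst hn
      simp only [hb, smul_zero, add_zero, if_true]
      calc ‖a z‖ ≤ C * w := ha z
        _ ≤ C * w * (1 + (4 : ℝ) ^ K * ((1 + ‖(0 : Site d)‖) ^ K)⁻¹) := by
            refine le_mul_of_one_le_right (by positivity) ?_
            have : 0 ≤ (4 : ℝ) ^ K * ((1 + ‖(0 : Site d)‖) ^ K)⁻¹ := by positivity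
            linarith
    · simp only [hb, if_neg hn, zero_add]
      calc ‖a (z + (L : ℤ) • n)‖ ≤ C * ((1 + ‖z + (L : ℤ) • n‖) ^ K)⁻¹ := ha _
        _ ≤ C * ((4 : ℝ) ^ K * w * ((1 + ‖n‖) ^ K)⁻¹) :=
            mul_le_mul_of_nonneg_left (inv_pow_translate_le hL hz hn K) hC
        _ = C * w * ((4 : ℝ) ^ K * ((1 + ‖n‖) ^ K)⁻¹) := by ring
  have ha_summ : Summable fun n : Site d => ‖a (z + (L : ℤ) • n)‖ :=
    Summable.of_nonneg_of_le (fun n => norm_nonneg _) hle hb_summ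
  refine (ha_summ.tsum_le_tsum hle hb_summ).trans (le_of_eq ?_)
  -- evaluate `Σ b`
  have h1 : Summable fun n : Site d => (if n = 0 then (1 : ℝ) else 0) :=
    summable_of_ne_finset_zero (s := {0}) fun n hn => by
      rw [Finset.mem_singleton] at hn; rw [if_neg hn]
  simp only [hb]
  rw [tsum_mul_left, h1.tsum_add (hS.mul_left _), tsum_ite_eq, tsum_mul_left]
  ring

/-- The same bound for the periodized kernel itself:
`|Σ_n a(z + Ln)| ≤ C (1 + 4^K S_K)(1 + |z|)^{-K}` for `2|z| ≤ L`, `L ≥ 1` — the torus kernel decays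
in the torus distance like the infinite-volume kernel, uniformly in `L`. [cite: GlimmJaffeQP1987, §7.3] -/
theorem norm_tsum_translate_le_of_decay {a : Site d → ℂ} {C : ℝ} {K : ℕ} (hC : 0 ≤ C)
    (ha : ∀ x, ‖a x‖ ≤ C * ((1 + ‖x‖) ^ K)⁻¹)
    (hS : Summable fun n : Site d => ((1 + ‖n‖) ^ K)⁻¹)
    {L : ℕ} (hL : 1 ≤ L) {z : Site d} (hz : 2 * ‖z‖ ≤ L) :
    ‖∑' n : Site d, a (z + (L : ℤ) • n)‖ ≤
      C * (1 + (4 : ℝ) ^ K * ∑' n : Site d, ((1 + ‖n‖) ^ K)⁻¹) * ((1 + ‖z‖) ^ K)⁻¹ := by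
  haveI : NeZero L := ⟨by omega⟩
  have hsum : Summable fun x : Site d => ‖a x‖ :=
    Summable.of_nonneg_of_le (fun x => norm_nonneg _) ha (hS.mul_left C)
  exact (norm_tsum_le_tsum_norm (summable_norm_translate_zsmul (L := L) hsum z)).trans
    (tsum_norm_translate_le_of_decay hC ha hS hL hz)

end Literature.Probability.LatticeModels

end
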